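import Mathlib
import HarnessLib
import Summits.ResolutionOfSingularities.ResolutionOfSingularities.Theorems.WildQuotientsWildQuotientResolutionS1aNpFrame

/-!
# S1a — K-FREE FRAME, (F-T8) models: TRANSPORT OF A NODE ALONG A RING ISOMORPHISM (grading, tame node, node data, augmentation ideal)

[OURS · L1 W4.5c · lead-1 g12; plan-1 A-KF v1 §2.4 «(F-T8) … an explicit presentation … so that identities in B′ are checked in a Laurent ring over a
localised polynomial ring by `ring`», R-F15b (6)] — NOT statements of the manuscript; counted 0; AI-level work, weaker than expert review. Crux
stmt-ResolutionOfSingularities-17941 `CyclicQuotientFourfolds`, line `s1a-logminvertex` v12 (`stub_reachLowerInF`). Pure algebra + one `NodeData` wrapper.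

The producer node of a blow-up chart is EXPOSED (`exists_nodeData_blowupChart_pin`) as the abstract chart ring `R^w(B)[(yT^d)⁻¹]`; instances compute in an
explicit MODEL (a localised polynomial ring) `Φ : ChartRing ≃+* B′`. This file moves the whole node across `Φ`:
* `mapGrading 𝒜 Φ d := Φ(𝒜 d)`, `mapGradedRing` — the transported grading is a ring grading (decomposition through `DFinsupp.mapRange.addEquiv`);
* `zeroRingEquiv : 𝒜 0 ≃+* mapGrading 𝒜 Φ 0`; `conj Φ σ := Φ⁻¹ ≫ σ ≫ Φ`, `augmentationIdeal_conj : aug (conj Φ σ) = (aug σ).map Φ`;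
* ★ `isTameNode_map` — tame nodes transport; ★ `NodeData.map` — node data on a chart transported to the model ring, with `NodeData.map_B` (rfl) and the
  pin `NodeData.coe_map_e : ((D.map Φ).e t : B′) = Φ (D.e t)`.
-/

set_option linter.dupNamespace false

noncomputable section

open CategoryTheory Limits AlgebraicGeometry TopologicalSpace Topology DirectSum
open Literature.AlgebraicGeometry.Resolution Literature.AlgebraicGeometry.RelativeSpec
open Summit.ResolutionOfSingularities.ResolutionOfSingularities.Theorems.WildQuotientResolution.S1
open Summit.ResolutionOfSingularities.ResolutionOfSingularities.Theorems.WildQuotientResolution.S1.ProducerStep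

namespace Summit.ResolutionOfSingularities.ResolutionOfSingularities.Theorems.WildQuotientResolution.S1.NodeTransport

universe u v

section Basic

variable {ι : Type v} {B B' : Type u} [CommRing B] [CommRing B'] (𝒜 : ι → AddSubgroup B) (Φ : B ≃+* B')

/-- **The transported grading** `Φ(𝒜 d)`. [OURS · L1 W4.5c] -/
def mapGrading : ι → AddSubgroup B' := fun d => (𝒜 d).map (Φ : B →+* B').toAddMonoidHom

/-- Membership in the transported grading. -/
theorem mem_mapGrading_iff {d : ι} {b' : B'} : b' ∈ mapGrading 𝒜 Φ d ↔ Φ.symm b' ∈ 𝒜 d := by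
  constructor
  · rintro ⟨b, hb, rfl⟩
    change Φ.symm (Φ b) ∈ 𝒜 d
    rwa [Φ.symm_apply_apply]
  · intro h
    exact ⟨Φ.symm b', h, Φ.apply_symm_apply b'⟩

/-- `Φ` maps pieces to pieces. -/
theorem map_mem_mapGrading {d : ι} {b : B} (hb : b ∈ 𝒜 d) : Φ b ∈ mapGrading 𝒜 Φ d :=
  ⟨b, hb, rfl⟩

/-- `Φ b ∈ Φ(𝒜 d) ↔ b ∈ 𝒜 d`. -/
theorem map_mem_mapGrading_iff {d : ι} {b : B} : Φ b ∈ mapGrading 𝒜 Φ d ↔ b ∈ 𝒜 d := by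
  rw [mem_mapGrading_iff, Φ.symm_apply_apply]

/-- Componentwise transport. -/
def componentEquiv (d : ι) : ↥(𝒜 d) ≃+ ↥(mapGrading 𝒜 Φ d) where
  toFun x := ⟨Φ x, map_mem_mapGrading 𝒜 Φ x.2⟩
  invFun y := ⟨Φ.symm y, (mem_mapGrading_iff 𝒜 Φ).mp y.2⟩
  left_inv := fun x => Subtype.ext (Φ.symm_apply_apply (x : B))
  right_inv := fun y => Subtype.ext (Φ.apply_symm_apply (y : B'))
  map_add' := fun x y => Subtype.ext (map_add Φ (x : B) (y : B))

end Basic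

section Grading

variable {ι : Type v} [AddCommGroup ι] [DecidableEq ι] {B B' : Type u} [CommRing B] [CommRing B']
  (𝒜 : ι → AddSubgroup B) (Φ : B ≃+* B') [GradedRing 𝒜]

/-- The transported grading is a graded monoid. -/
theorem mapGrading_gradedMonoid : SetLike.GradedMonoid (mapGrading 𝒜 Φ) :=
  { one_mem := by
      rw [mem_mapGrading_iff, map_one]
      exact SetLike.one_mem_graded 𝒜
    mul_mem := fun i j a b ha hb => by
      rw [mem_mapGrading_iff] at ha hb ⊢
      rw [map_mul]
      exact SetLike.mul_mem_graded ha hb }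

/-- Transport of direct-sum elements. -/
def sumEquiv : (⨁ d, ↥(𝒜 d)) ≃+ ⨁ d, ↥(mapGrading 𝒜 Φ d) :=
  DFinsupp.mapRange.addEquiv fun d => componentEquiv 𝒜 Φ d

/-- Transport of a single-component element. -/
theorem sumEquiv_of (d : ι) (m : ↥(𝒜 d)) :
    sumEquiv 𝒜 Φ (DirectSum.of (fun i => ↥(𝒜 i)) d m) = DirectSum.of (fun i => ↥(mapGrading 𝒜 Φ i)) d (componentEquiv 𝒜 Φ d m) := by
  change DFinsupp.mapRange (fun i x => componentEquiv 𝒜 Φ i x) (fun i => map_zero _) (DFinsupp.single d m : Π₀ i, ↥(𝒜 i)) =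
    (DFinsupp.single d (componentEquiv 𝒜 Φ d m) : Π₀ i, ↥(mapGrading 𝒜 Φ i))
  exact DFinsupp.mapRange_single

/-- The underlying element of a transported sum is `Φ` of the underlying element. -/
theorem coe_sumEquiv (x : ⨁ d, ↥(𝒜 d)) :
    DirectSum.coeAddMonoidHom (mapGrading 𝒜 Φ) (sumEquiv 𝒜 Φ x) = Φ (DirectSum.coeAddMonoidHom 𝒜 x) := by
  have key : (DirectSum.coeAddMonoidHom (mapGrading 𝒜 Φ)).comp (sumEquiv 𝒜 Φ).toAddMonoidHom =
      (Φ : B →+* B').toAddMonoidHom.comp (DirectSum.coeAddMonoidHom 𝒜) := by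
    refine DirectSum.addHom_ext fun i m => ?_
    rw [AddMonoidHom.comp_apply, AddMonoidHom.comp_apply, AddEquiv.coe_toAddMonoidHom, sumEquiv_of,
      DirectSum.coeAddMonoidHom_of, DirectSum.coeAddMonoidHom_of]
    rfl
  exact DFunLike.congr_fun key x

/-- The decomposition of the transported grading. -/
@[reducible] def mapDecomposition : DirectSum.Decomposition (mapGrading 𝒜 Φ) where
  decompose' := fun b' => sumEquiv 𝒜 Φ (DirectSum.decompose 𝒜 (Φ.symm b'))
  left_inv := fun b' => by
    change DirectSum.coeAddMonoidHom (mapGrading 𝒜 Φ) (sumEquiv 𝒜 Φ (DirectSum.decompose 𝒜 (Φ.symm b'))) = b'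
    rw [coe_sumEquiv]
    have : DirectSum.coeAddMonoidHom 𝒜 (DirectSum.decompose 𝒜 (Φ.symm b')) = Φ.symm b' := DirectSum.Decomposition.left_inv (ℳ := 𝒜) _
    rw [this, Φ.apply_symm_apply]
  right_inv := fun x => by
    obtain ⟨y, rfl⟩ := (sumEquiv 𝒜 Φ).surjective x
    change sumEquiv 𝒜 Φ (DirectSum.decompose 𝒜 (Φ.symm (DirectSum.coeAddMonoidHom (mapGrading 𝒜 Φ) (sumEquiv 𝒜 Φ y)))) = sumEquiv 𝒜 Φ y
    rw [coe_sumEquiv, Φ.symm_apply_apply]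
    congr 1
    exact DirectSum.Decomposition.right_inv (ℳ := 𝒜) y

/-- **The transported grading is a ring grading.** [OURS · L1 W4.5c] -/
@[reducible] def mapGradedRing : GradedRing (mapGrading 𝒜 Φ) :=
  { mapGrading_gradedMonoid 𝒜 Φ, mapDecomposition 𝒜 Φ with }

/-- **The degree-0 rings correspond.** -/
def zeroRingEquiv : letI := mapGradedRing 𝒜 Φ; ↥(𝒜 0) ≃+* ↥(mapGrading 𝒜 Φ 0) :=
  letI := mapGradedRing 𝒜 Φ
  { componentEquiv 𝒜 Φ 0 with
    map_mul' := fun x y => Subtype.ext (by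
      change Φ ((x : B) * (y : B)) = Φ (x : B) * Φ (y : B)
      rw [map_mul]) }

/-- The degree-0 correspondence on underlying elements. -/
theorem coe_zeroRingEquiv (x : ↥(𝒜 0)) :
    letI := mapGradedRing 𝒜 Φ; ((zeroRingEquiv 𝒜 Φ x : ↥(mapGrading 𝒜 Φ 0)) : B') = Φ (x : B) := rfl

end Grading

/-! ## Conjugate automorphism and its augmentation ideal -/

section Conj

variable {B B' : Type u} [CommRing B] [CommRing B'] (Φ : B ≃+* B') (σ : B ≃+* B)

/-- **The conjugate automorphism** `Φ⁻¹ ≫ σ ≫ Φ` of the model ring. -/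
def conj : B' ≃+* B' := Φ.symm.trans (σ.trans Φ)

/-- `conj Φ σ x = Φ (σ (Φ⁻¹ x))`. -/
@[simp] theorem conj_apply (x : B') : conj Φ σ x = Φ (σ (Φ.symm x)) := rfl

/-- `conj Φ σ (Φ b) = Φ (σ b)`. -/
theorem conj_apply_map (b : B) : conj Φ σ (Φ b) = Φ (σ b) := by
  rw [conj_apply, Φ.symm_apply_apply]

/-- Iterates of the conjugate. -/
theorem conj_iterate (n : ℕ) (x : B') : (⇑(conj Φ σ))^[n] x = Φ ((⇑σ)^[n] (Φ.symm x)) := by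
  induction n generalizing x with
  | zero => simp
  | succ n ih => rw [Function.iterate_succ_apply, ih, conj_apply, Φ.symm_apply_apply, ← Function.iterate_succ_apply σ]

/-- **The augmentation ideal of the conjugate is the image of the augmentation ideal.** -/
theorem augmentationIdeal_conj : augmentationIdeal (conj Φ σ) = (augmentationIdeal σ).map (Φ : B →+* B') := by
  apply le_antisymm
  · rw [augmentationIdeal, Ideal.span_le]
    rintro _ ⟨x, rfl⟩
    rw [SetLike.mem_coe]
    change Φ (σ (Φ.symm x)) - x ∈ _
    have : Φ (σ (Φ.symm x)) - x = Φ (σ (Φ.symm x) - Φ.symm x) := by rw [map_sub, Φ.apply_symm_apply]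
    rw [this]
    exact Ideal.mem_map_of_mem _ (sub_mem_augmentationIdeal σ _)
  · rw [augmentationIdeal, Ideal.map_span, Ideal.span_le]
    rintro _ ⟨_, ⟨b, rfl⟩, rfl⟩
    rw [SetLike.mem_coe, RingHom.coe_coe, map_sub, ← conj_apply_map Φ σ b]
    exact sub_mem_augmentationIdeal _ _

end Conj

/-! ## Tame nodes transport -/

section Tame

variable {ι : Type v} [AddCommGroup ι] [DecidableEq ι] {B B' : Type u} [CommRing B] [CommRing B']
  (𝒜 : ι → AddSubgroup B) [GradedRing 𝒜] (Φ : B ≃+* B')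

/-- ★ **Tame nodes transport along ring isomorphisms** (grading `Φ(𝒜 ·)`, automorphism `Φ⁻¹ ≫ σ ≫ Φ`). [OURS · L1 W4.5c] -/
theorem isTameNode_map (p : ℕ) (σ : B ≃+* B) (h : IsTameNode p B 𝒜 σ) :
    letI := mapGradedRing 𝒜 Φ
    IsTameNode p B' (mapGrading 𝒜 Φ) (conj Φ σ) := by
  letI := mapGradedRing 𝒜 Φ
  classical
  obtain ⟨hN, hR, ⟨s, hs, hfi⟩, ⟨t, ht⟩, hσ, hp⟩ := h
  have hN' : IsNoetherianRing B' := isNoetherianRing_of_ringEquiv B Φ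
  have hR' : IsRegularRing B' := by haveI := hR; exact IsRegularRing.of_ringEquiv Φ
  have hT1' : ∀ d ∈ s, ∃ u : B', IsUnit u ∧ u ∈ mapGrading 𝒜 Φ d := fun d hd => by
    obtain ⟨w, hw, hmem⟩ := hs d hd
    exact ⟨Φ w, hw.map Φ, map_mem_mapGrading 𝒜 Φ hmem⟩
  refine ⟨hN', hR', ⟨s, hT1', hfi⟩, ⟨t.image Φ, ?_⟩, fun d b' hb' => ?_, fun b' => ?_⟩
  · have h1 : (((mapGrading 𝒜 Φ 0 : AddSubgroup B') : Set B') ∪ ↑(t.image Φ)) = Φ '' ((((𝒜 0 : AddSubgroup B)) : Set B) ∪ ↑t) := by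
      rw [Set.image_union, Finset.coe_image]
      rfl
    rw [h1, ← RingHom.coe_coe, ← RingHom.map_closure, ht, ← RingHom.range_eq_map]
    exact RingHom.range_eq_top.mpr Φ.surjective
  · rw [mem_mapGrading_iff] at hb' ⊢
    rw [conj_apply, Φ.symm_apply_apply]
    exact hσ d _ hb'
  · rw [conj_iterate, hp, Φ.apply_symm_apply]

end Tame

/-! ## Node data transport -/

section Node

variable {p : ℕ} {V Y : Scheme.{u}} {q : V ⟶ Y} {G : Type u} [Group G] {ρ : ActionOver q G} {g₀ : G} {O : ρ.StableAffineOpens}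

/-- ★ **Node data transported to a model ring** `Φ : D.B ≃+* B′`: node ring `B′`, grading `Φ(𝒜 ·)`, automorphism `Φ⁻¹ ≫ σ ≫ Φ`, coordinate iso
`e ≫ Φ|₀`. [OURS · L1 W4.5c · (F-T8) models] -/
@[reducible] def _root_.Summit.ResolutionOfSingularities.ResolutionOfSingularities.Theorems.WildQuotientResolution.S1.NpFrame.NodeData.map
    (D : NpFrame.NodeData p ρ g₀ O) {B' : Type u} [CommRing B'] (Φ : letI := D.instCommRing; D.B ≃+* B') : NpFrame.NodeData p ρ g₀ O :=
  letI := D.instCommRing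
  letI := D.instGradedRing
  letI := mapGradedRing D.𝒜 Φ
  { affine := D.affine
    m := D.m
    r := D.r
    B := B'
    𝒜 := mapGrading D.𝒜 Φ
    instGradedRing := mapGradedRing D.𝒜 Φ
    σ := conj Φ D.σ
    e := D.e.trans (zeroRingEquiv D.𝒜 Φ)
    tame := isTameNode_map D.𝒜 Φ p D.σ D.tame
    intertwine := fun t => by
      change Φ ((D.e (GoodCharts.actO ρ O g₀ t) : ↥(D.𝒜 0)) : D.B) = Φ (D.σ (Φ.symm (Φ ((D.e t : ↥(D.𝒜 0)) : D.B))))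
      rw [D.intertwine t, Φ.symm_apply_apply] }

variable (D : NpFrame.NodeData p ρ g₀ O) {B' : Type u} [CommRing B'] (Φ : letI := D.instCommRing; D.B ≃+* B')

/-- The model ring. -/
theorem map_B : (D.map Φ).B = B' := rfl

/-- **The pin of the transported coordinate iso**: `((D.map Φ).e t : B′) = Φ (D.e t)`. -/
theorem coe_map_e (t : Γ(V, O.1)) :
    letI := D.instCommRing; letI := D.instGradedRing
    (((D.map Φ).e t : ↥((D.map Φ).𝒜 0)) : B') = Φ ((D.e t : ↥(D.𝒜 0)) : D.B) := rfl

/-- The transported automorphism. -/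
theorem map_σ_apply (x : B') : letI := D.instCommRing; (D.map Φ).σ x = Φ (D.σ (Φ.symm x)) := rfl

/-- The augmentation ideal of the transported node is the image. -/
theorem augmentationIdeal_map : letI := D.instCommRing; augmentationIdeal (D.map Φ).σ = (augmentationIdeal D.σ).map (Φ : D.B →+* B') :=
  letI := D.instCommRing
  augmentationIdeal_conj Φ D.σ

end Node

end Summit.ResolutionOfSingularities.ResolutionOfSingularities.Theorems.WildQuotientResolution.S1.NodeTransport

end
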